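import Summits.SmoothPoincare4.SmoothPoincare4.Theses.EntropyLadder
import Summits.SmoothPoincare4.SmoothPoincare4.Theses.ConvexityLadder
import Summits.SmoothPoincare4.SmoothPoincare4.Theses.RicciTranscript
import Literature.Topology.FourManifolds.Morse
import HarnessLib

/-!
# Stub `stub_presentationSpheresStandard` of line `hurwitz-deletion-presentation` for crux
# `ConvexBisection.AcyclicBisectionRigidity` (stmt-SmoothPoincare4-10507): it IS item
# stmt-SmoothPoincare4-3717 verbatim — kernel-checked identification

The registered stub 4 of the skeleton
`Cruxes/AcyclicBisectionRigidity/Lines/hurwitz_deletion_presentation.lean` ("a homotopy 4-sphere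
bounding a compact contractible smooth 5-manifold carrying a Morse function adapted to the boundary
all of whose critical points have index `≤ 2` is diffeomorphic to `S⁴`") is the OPEN shared crux item
stmt-SmoothPoincare4-3717 `PresentationSpheresStandard`, typed three times in the tree as the route
declarations

* `Summit.SmoothPoincare4.SmoothPoincare4.Theses.EntropyLadder.PresentationSpheresStandard`,
* `Summit.SmoothPoincare4.SmoothPoincare4.Theses.ConvexityLadder.PresentationSpheresStandard`,
* `Summit.SmoothPoincare4.SmoothPoincare4.Theses.RicciTranscript.PresentationSpheresStandard`.

Item 3717 is open (ledger status `open`; no Theorems module proves any of the three declarations; it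
is the 5-dimensional shadow of the Andrews–Curtis problem and is implied by the smooth 4-dimensional
Poincaré conjecture), so the stub is not discharged here.  What this file certifies, by `Iff.rfl` and
an `intro`/`exact` term, is that the stub's statement and each of the three route declarations are
the SAME proposition definitionally (binder shapes `4 + 1`, `IsMorseAdapted`, `morseIndex … ≤ 2`, the
boundary-embedding clause all agree): closing item 3717 on any of the three routes closes stub 4 of
the line by `presentationSpheresStandard_of_item3717 h M e hW`, with no glue; conversely a proof of
stub 4 closes item 3717 on all three routes (`item3717_of_stub`).  Pure logic: no `sorry`, no named
facts.
-/

noncomputable section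

-- the prescribed namespace `Summit.<P>.<Sub>.…` duplicates `SmoothPoincare4` (P = Sub)
set_option linter.dupNamespace false

open scoped Manifold ContDiff Topology ContinuousMap
open Set Function

namespace Summit.SmoothPoincare4.SmoothPoincare4.Theorems.AcyclicBisectionRigidity.HurwitzDeletionPresentation

open Summit.SmoothPoincare4.SmoothPoincare4.Theses

/-- **Stub 4 = item 3717 verbatim, kernel-checked**: the route item
`EntropyLadder.PresentationSpheresStandard` (stmt-SmoothPoincare4-3717, shared with ConvexityLadder and
RicciTranscript) implies — indeed is — the registered statement of `stub_presentationSpheresStandard`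
of the line `hurwitz-deletion-presentation`, spelled out in full: a Hausdorff second-countable `C^∞`
4-manifold `M ≃ₕ S⁴` that bounds a compact contractible `C^∞` 5-manifold-with-boundary `W` carrying a
Morse function adapted to `∂W` with all critical points of index `≤ 2` is diffeomorphic to `S⁴`.  The
lead discharges the stub by `presentationSpheresStandard_of_item3717 h M e hW` the day item 3717
closes. -/
theorem presentationSpheresStandard_of_item3717
    (h : Summit.SmoothPoincare4.SmoothPoincare4.Theses.EntropyLadder.PresentationSpheresStandard) :
    ∀ (M : Type) [TopologicalSpace M] [T2Space M] [SecondCountableTopology M]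
      [ChartedSpace (EuclideanSpace ℝ (Fin 4)) M] [IsManifold (𝓡 4) ∞ M],
      M ≃ₕ Metric.sphere (0 : EuclideanSpace ℝ (Fin 5)) 1 →
      (∃ (W : Type) (_ : TopologicalSpace W) (_ : T2Space W) (_ : SecondCountableTopology W)
        (_ : ChartedSpace (EuclideanHalfSpace (4 + 1)) W) (_ : IsManifold (𝓡∂ (4 + 1)) ∞ W)
        (_ : CompactSpace W),
        ContractibleSpace W ∧
        (∃ f : W → ℝ, Literature.Topology.FourManifolds.IsMorseAdapted (𝓡∂ (4 + 1)) f ∧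
          ∀ z, Literature.Topology.FourManifolds.IsMCriticalPt (𝓡∂ (4 + 1)) f z →
            Literature.Topology.FourManifolds.morseIndex (𝓡∂ (4 + 1)) f z ≤ 2) ∧
        ∃ φ : M → W, Manifold.IsSmoothEmbedding (𝓡 4) (𝓡∂ (4 + 1)) ∞ φ ∧
          Set.range φ = (𝓡∂ (4 + 1)).boundary W) →
      Nonempty (M ≃ₘ⟮𝓡 4, 𝓡 4⟯ Metric.sphere (0 : EuclideanSpace ℝ (Fin 5)) 1) :=
  fun M _ _ _ _ _ e hW => h M e hW

/-- **The registered statement of stub 4 is DEFINITIONALLY item stmt-SmoothPoincare4-3717**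
(`EntropyLadder.PresentationSpheresStandard`): `Iff.rfl`. -/
theorem stub_iff_item3717 :
    (∀ (M : Type) [TopologicalSpace M] [T2Space M] [SecondCountableTopology M]
      [ChartedSpace (EuclideanSpace ℝ (Fin 4)) M] [IsManifold (𝓡 4) ∞ M],
      M ≃ₕ Metric.sphere (0 : EuclideanSpace ℝ (Fin 5)) 1 →
      (∃ (W : Type) (_ : TopologicalSpace W) (_ : T2Space W) (_ : SecondCountableTopology W)
        (_ : ChartedSpace (EuclideanHalfSpace (4 + 1)) W) (_ : IsManifold (𝓡∂ (4 + 1)) ∞ W)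
        (_ : CompactSpace W),
        ContractibleSpace W ∧
        (∃ f : W → ℝ, Literature.Topology.FourManifolds.IsMorseAdapted (𝓡∂ (4 + 1)) f ∧
          ∀ z, Literature.Topology.FourManifolds.IsMCriticalPt (𝓡∂ (4 + 1)) f z →
            Literature.Topology.FourManifolds.morseIndex (𝓡∂ (4 + 1)) f z ≤ 2) ∧
        ∃ φ : M → W, Manifold.IsSmoothEmbedding (𝓡 4) (𝓡∂ (4 + 1)) ∞ φ ∧
          Set.range φ = (𝓡∂ (4 + 1)).boundary W) →
      Nonempty (M ≃ₘ⟮𝓡 4, 𝓡 4⟯ Metric.sphere (0 : EuclideanSpace ℝ (Fin 5)) 1)) ↔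
    EntropyLadder.PresentationSpheresStandard :=
  Iff.rfl

/-- The three route copies of item stmt-SmoothPoincare4-3717 are one proposition:
EntropyLadder's is ConvexityLadder's, by `Iff.rfl`. -/
theorem entropyLadder_iff_convexityLadder :
    EntropyLadder.PresentationSpheresStandard ↔ ConvexityLadder.PresentationSpheresStandard :=
  Iff.rfl

/-- The three route copies of item stmt-SmoothPoincare4-3717 are one proposition:
EntropyLadder's is RicciTranscript's, by `Iff.rfl`. -/
theorem entropyLadder_iff_ricciTranscript :
    EntropyLadder.PresentationSpheresStandard ↔ RicciTranscript.PresentationSpheresStandard :=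
  Iff.rfl

/-- Converse bookkeeping: a proof of the registered statement of stub 4 of the line closes item
stmt-SmoothPoincare4-3717 on all three routes (EntropyLadder, ConvexityLadder, RicciTranscript) at
once. -/
theorem item3717_of_stub
    (h : ∀ (M : Type) [TopologicalSpace M] [T2Space M] [SecondCountableTopology M]
      [ChartedSpace (EuclideanSpace ℝ (Fin 4)) M] [IsManifold (𝓡 4) ∞ M],
      M ≃ₕ Metric.sphere (0 : EuclideanSpace ℝ (Fin 5)) 1 →
      (∃ (W : Type) (_ : TopologicalSpace W) (_ : T2Space W) (_ : SecondCountableTopology W)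
        (_ : ChartedSpace (EuclideanHalfSpace (4 + 1)) W) (_ : IsManifold (𝓡∂ (4 + 1)) ∞ W)
        (_ : CompactSpace W),
        ContractibleSpace W ∧
        (∃ f : W → ℝ, Literature.Topology.FourManifolds.IsMorseAdapted (𝓡∂ (4 + 1)) f ∧
          ∀ z, Literature.Topology.FourManifolds.IsMCriticalPt (𝓡∂ (4 + 1)) f z →
            Literature.Topology.FourManifolds.morseIndex (𝓡∂ (4 + 1)) f z ≤ 2) ∧
        ∃ φ : M → W, Manifold.IsSmoothEmbedding (𝓡 4) (𝓡∂ (4 + 1)) ∞ φ ∧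
          Set.range φ = (𝓡∂ (4 + 1)).boundary W) →
      Nonempty (M ≃ₘ⟮𝓡 4, 𝓡 4⟯ Metric.sphere (0 : EuclideanSpace ℝ (Fin 5)) 1)) :
    EntropyLadder.PresentationSpheresStandard ∧ ConvexityLadder.PresentationSpheresStandard ∧
      RicciTranscript.PresentationSpheresStandard :=
  ⟨h, h, h⟩

end Summit.SmoothPoincare4.SmoothPoincare4.Theorems.AcyclicBisectionRigidity.HurwitzDeletionPresentation

end
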